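import Summits.ABC.IUTFork.LDHGenuinePerImagePrintIsm
import Summits.ABC.IUTFork.LDHGenuineStepVSum
import Summits.ABC.IUTFork.LDHInitialThetaDataPerPrime
import Literature.IUT.LogVolume.GenuineLogThetaExactVolume
import Literature.IUT.LogVolume.TensorPacketSlotTwists
import HarnessLib

/-!
# The fork at [IUTchIII] Corollary 3.12, L-DH level, READING (U) — the hull of the UNION of the possible images — with (Ind1) := the
# capsule permutations and (Ind2) := PRINT's factorwise `Ism`: at SLOT-CONSTANT inputs (one place over each support prime, e.g.
# `F_mod` of degree one) the Θ-side is again the BARE value `−deĝ̲_lgp(P_Θ)`, so the (U)-inequality FAILS at every genuine datum of a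
# RATIONAL `j`-invariant with `l ≥ 5`, `log q^{∤2l}(λ) ≥ 24`
# (abc-iut cell, crux ThetaPartII = stmt-ABC-19678; row «C:PERIMAGE-PRINT-ISM», part 5: the (U)-twin; [IUTchIII] Cor. 3.12 p. 174;
# [IUTchIV] Thm. 1.10 Step (v) p. 27–28 «symmetrizing with respect to the choice of i†»; Dupuy–Hilado §4.7, §4.11–4.12)

Record-only PROOF file (D-0012; no definition, no `Prop` fact) of the abc-iut cell (WAVE-3 discharge seat abc-iut-c312-d1, gen 11; sequel of
`LDHGenuinePrintIsmPacket` (p509534), `LDHGenuinePerImagePrintIsm` (p510764)). TAKES NO SIDE on [IUTchIII] Cor. 3.12.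

Part 1 proved (`localFields_lnνLp_hull_printInd2_slotUnion_eq`): over any family `H` DOMINATED BY PRINT's (Ind2) (factorwise abc-iut-c312-1
`Real.ismIsm (analyticLogv K) v̲_b` = unit homotheties, abc-iut-w5-d216 p452975) the (U)-region `hull(⋃_{g∈H} g(⋃_σ σ·O_𝕃(−P_Θ)))` has the
`ln ν̄_{𝕃_p}` of the hulls of the (Ind1)-SLOT UNIONS alone. THIS FILE computes that value where the slot union collapses:

* **`realPrimePacketWith_slotUnion_eq_pilotRegion_of_norm_eq`** — on the real packet (any local-field family, any shell), if along a collection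
  `v⃗` in degree `j = i+1` the theta values `t_{i,v_a}` all have the SAME absolute value, the (Ind1)-slot union `⋃_σ σ·(ι_j(t_{i,v_{σ(j)}})·(R_I)^∼)`
  IS the bare region `ι_j(t_{i,v_j})·(R_I)^∼` (this lineage's `iota_smul_normalizedPacket_eq_of_norm_eq`: equal-size twists at different slots
  span the same translate; [IUTchIV] Step (v)'s symmetrisation is exact);
* `localFields_lnνLp_hull_printInd2_slotUnion_eq_pilotRegion_of_norm_eq` — hence on the GENUINE packet of a place section, for slot-constant theta
  values and print-dominated `H`: reading (U) over `H` = the bare `ln ν̄_{𝕃_p}(O_𝕃(−P_Θ)_p)`;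
* **`ThetaVolumeInput.sum_lnνLp_hull_printInd2_union_eq_neg_ndegLgp_of_norm_eq`** / `…_of_finrank_eq_one` — at the input level, for slot-constant
  idele norms (automatic when `[F₀ : ℚ] = 1`, abc-iut-S2's `placesOver_subsingleton_of_finrank_eq_one`): `Σ_{p∈T(I)} ln ν̄_{𝕃_p}((U)-region over
  H) = −deĝ̲_lgp(P_Θ)` — ZERO (Ind1)+(Ind2)-gain; `gap_le_arch_of_union_printInd2_of_finrank_eq_one` — the (U)-inequality with that Θ-side
  squeezes to `deĝ̲_lgp(P_Θ) − deĝ̲(P_q) ≤ ((l+5)/4)·log π`;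
* **`Cor22.ThetaVolumeDatumAt.not_union_printInd2_of_le_of_j_mem_range`** — at the Θ-data of a point `P ∈ U` with `l ≥ 5`, `log q^{∤{2,l}}(λ) ≥ 24`,
  for every genuine datum `T` whose curve has RATIONAL `j`-invariant (`j(E_F) ∈ ℚ`, so `[F_mod : ℚ] = 1`, abc-iut-c312-3's
  `finrank_fieldOfModuli_eq_one_of_j_mem_range`) and every print-dominated `H`: `¬ (−|log(q)| ≤ [(U)-Θ-side over H] + ((l+5)/4)·log π)`;
  `…_ratPoint` — in particular at EVERY genuine datum over a RATIONAL point `ratPoint q`.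

READING (numbers about OUR typed objects; the C LEAD's words decide the booking): for `F_mod` of degree one — every tabulated rational (triple, l)
of the cell — BOTH typed readings of [IUTchIII] Cor. 3.12, (P) (part 2) and (U) (this file: Mochizuki's «holomorphic hull of the union of the possible
images», with Dupuy–Hilado's (Ind1) = capsule permutations), computed with (Ind2) := PRINT's factorwise `Ism` as typed by c312-1, reduce to the BARE
Θ-value and FAIL wherever `log q^{∤2l}(λ) ≥ 24`; the gain that makes the cell's TYPED Corollary hold at the tabulated data lives in the Dupuy–Hilado
container outside `ℤ_p^×` (or in print's (Ind1) STRIP part, abc-iut-c312-1's R-rows, not modelled by the capsule permutations). Whether print's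
EFFECTIVE (Ind2) is this `Ism` (F-B28-1), and (Ind1)'s strip part, (Ind3), the log-link, Cor. 3.12 itself, are untouched; refuted-as-typed ≠ refuted in
print; nothing here asserts that abc is proved or refuted; no side taken. [cite: Mochizuki2012, IUTchIII Cor. 3.12 p. 173–174; Thm. 3.11 (i) p. 154]
[cite: Mochizuki2012, IUTchIV Thm. 1.10 Step (v) p. 27–28] [cite: Mochizuki2012, IUTchII Ex. 1.8 (iv) p. 39] [cite: DupuyHilado2025, §4.7, §4.9,
§4.11, §4.12, Thm. 3.10.1] [claim: Mochizuki2012, status: disputed] for every IUT quotation. Axioms: standard three.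
-/

noncomputable section

open Set Module NumberField IsDedekindDomain
open scoped Pointwise TensorProduct

/-! ## 1. Packet level: at a slot-constant collection the (Ind1)-slot union IS the bare region -/

namespace Literature.IUT.LogVolume

section RealPacketWith

variable {F : Type} [Field F] [NumberField F]
variable (p : ℕ) [Fact p.Prime] (𝔽 : LocalFields F p)
variable (c : (j : ℕ) → (Fin (j + 1) → placesOver F p) → ℚ_[p]) (hc0 : ∀ j e, c j e ≠ 0)
  (hcσ : ∀ (j : ℕ) (τ : Equiv.Perm (Fin (j + 1))) (e : Fin (j + 1) → placesOver F p), c j (e ∘ τ) = c j e)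

/-- **[IUTchIV] Step (v)'s symmetrisation is EXACT at a slot-constant collection**: on the real packet, if the theta values along `v⃗ = e` in degree
`j = i+1` all have the same absolute value, then the (Ind1)-slot union `⋃_σ σ·O_𝕃(−P_Θ)_{v⃗∘σ} = ⋃_a ι_a(t_{i,v_a})·(R_I)^∼` EQUALS the bare
region `ι_j(t_{i,v_j})·(R_I)^∼` (abc-iut-c312-3's `realPrimePacketWith_indOneUnion_pilotRegion_eq_slotUnion` + this lineage's
`iota_smul_normalizedPacket_eq_of_norm_eq`). [cite: Mochizuki2012, IUTchIV Thm. 1.10 Step (v) p. 27–28] [cite: DupuyHilado2025, §4.7] -/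
theorem realPrimePacketWith_slotUnion_eq_pilotRegion_of_norm_eq {lstar : ℕ}
    (t : Fin lstar → (v : placesOver F p) → (𝔽.k v)ˣ) (i : Fin lstar) (e : Fin ((i : ℕ) + 1 + 1) → placesOver F p)
    (hconst : ∀ a, ‖(t i (e a) : 𝔽.k (e a))‖ = ‖(t i (e (Fin.last _)) : 𝔽.k (e (Fin.last _)))‖) :
    (⋃ τ : Equiv.Perm (Fin ((i : ℕ) + 1 + 1)), (realPrimePacketWith p 𝔽 c hc0 hcσ).perm τ e ''
        (realPrimePacketWith p 𝔽 c hc0 hcσ).pilotRegion t ((i : ℕ) + 1) (e ∘ τ)) =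
      (realPrimePacketWith p 𝔽 c hc0 hcσ).pilotRegion t ((i : ℕ) + 1) e := by
  rw [realPrimePacketWith_indOneUnion_pilotRegion_eq_slotUnion, realPrimePacketWith_pilotRegion_succ_eq]
  apply Set.Subset.antisymm
  · exact Set.iUnion_subset fun a =>
      (iota_smul_normalizedPacket_eq_of_norm_eq p (fun b => 𝔽.k (e b)) (DFac p (fun b => 𝔽.k (e b)))
        (dEquiv p (fun b => 𝔽.k (e b))) a (Fin.last _) (Units.ne_zero _) (hconst a)).le
  · exact Set.subset_iUnion (fun a => iota p (fun b => 𝔽.k (e b)) a (t i (e a) : 𝔽.k (e a)) •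
      (normalizedPacket p (fun b => 𝔽.k (e b)) : Set (PacketAlgebra p (fun b => 𝔽.k (e b))))) (Fin.last _)

/-- Hence, at slot-constant theta values, for ANY family `H` of packet automorphisms the (U)-region over `H` — `hull(⋃_{g∈H} g(slot union))` —
coincides degree by degree (`1 ≤ j ≤ ℓ⋆`) with the (P)-region over `H`, and so do their `ln ν̄_{𝕃_p}`. [cite: DupuyHilado2025, §4.7, §4.11–4.12] -/
theorem realPrimePacketWith_lnνLp_hull_orbitH_slotUnion_eq_hull_orbitH_of_norm_eq {lstar : ℕ}
    (t : Fin lstar → (v : placesOver F p) → (𝔽.k v)ˣ)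
    (hconst : ∀ (i : Fin lstar) (e : Fin ((i : ℕ) + 1 + 1) → placesOver F p) (a : Fin ((i : ℕ) + 1 + 1)),
      ‖(t i (e a) : 𝔽.k (e a))‖ = ‖(t i (e (Fin.last _)) : 𝔽.k (e (Fin.last _)))‖)
    (H : (j : ℕ) → (e : Fin (j + 1) → placesOver F p) →
      Subgroup (PacketAlgebra p (fun b => 𝔽.k (e b)) ≃ₗ[ℚ_[p]] PacketAlgebra p (fun b => 𝔽.k (e b)))) :
    (realPrimePacketWith p 𝔽 c hc0 hcσ).lnνLp lstar (fun j e =>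
        packetHull p (fun b => 𝔽.k (e b))
          (⋃ g : H j e, (g : PacketAlgebra p (fun b => 𝔽.k (e b)) ≃ₗ[ℚ_[p]] PacketAlgebra p (fun b => 𝔽.k (e b))) ''
            ⋃ τ : Equiv.Perm (Fin (j + 1)), (realPrimePacketWith p 𝔽 c hc0 hcσ).perm τ e ''
              (realPrimePacketWith p 𝔽 c hc0 hcσ).pilotRegion t j (e ∘ τ))) =
      (realPrimePacketWith p 𝔽 c hc0 hcσ).lnνLp lstar (fun j e =>
        packetHull p (fun b => 𝔽.k (e b))
          (⋃ g : H j e, (g : PacketAlgebra p (fun b => 𝔽.k (e b)) ≃ₗ[ℚ_[p]] PacketAlgebra p (fun b => 𝔽.k (e b))) ''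
            (realPrimePacketWith p 𝔽 c hc0 hcσ).pilotRegion t j e)) := by
  refine (realPrimePacketWith p 𝔽 c hc0 hcσ).lnνLp_congr_of_succ lstar fun i e => ?_
  show packetHull p (fun b => 𝔽.k (e b)) _ = packetHull p (fun b => 𝔽.k (e b)) _
  refine congrArg (packetHull p (fun b => 𝔽.k (e b))) (Set.iUnion_congr fun g => ?_)
  exact congrArg (fun S => (g : PacketAlgebra p (fun b => 𝔽.k (e b)) ≃ₗ[ℚ_[p]] PacketAlgebra p (fun b => 𝔽.k (e b))) '' S)
    (realPrimePacketWith_slotUnion_eq_pilotRegion_of_norm_eq p 𝔽 c hc0 hcσ t i e (hconst i e))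

end RealPacketWith

end Literature.IUT.LogVolume

/-! ## 2. The genuine packet of a place section: reading (U) over PRINT's (Ind2) at slot-constant theta values is the BARE value -/

namespace Summit.ABC.IUTFork

open Literature.IUT.LogVolume Literature.NumberTheory.NumberFields Thm311.Real

section GenuinePacket

variable {F₀ : Type} [Field F₀] [NumberField F₀] {K : Type} [Field K] [NumberField K] [Algebra F₀ K]
variable (σ : PlaceSection F₀ K) (p : ℕ) [hp : Fact p.Prime]
variable (c : (j : ℕ) → (Fin (j + 1) → placesOver F₀ p) → ℚ_[p]) (hc0 : ∀ j e, c j e ≠ 0)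
  (hcσ : ∀ (j : ℕ) (τ : Equiv.Perm (Fin (j + 1))) (e : Fin (j + 1) → placesOver F₀ p), c j (e ∘ τ) = c j e)

/-- **READING (U) OVER PRINT's (Ind2) IS THE BARE VALUE at slot-constant theta values** (genuine packet of a place section, any shell): for a
print-dominated family `H` (factorwise `Real.ismIsm (analyticLogv K) v̲_b`), `ln ν̄_{𝕃_p}(v⃗ ↦ hull(⋃_{g∈H_{v⃗}} g(⋃_σ σ·O_𝕃(−P_Θ)))) = ln ν̄_{𝕃_p}(O_𝕃(−P_Θ)_p)`
(§1 + part 1's `localFields_lnνLp_hull_printInd2_eq_pilotRegion`). [cite: Mochizuki2012, IUTchIII Cor. 3.12 p. 174; Thm. 3.11 (i) p. 154]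
[cite: DupuyHilado2025, §4.7, §4.9, §4.12] [claim: Mochizuki2012, status: disputed] -/
theorem localFields_lnνLp_hull_printInd2_slotUnion_eq_pilotRegion_of_norm_eq {lstar : ℕ}
    (t : Fin lstar → (v : placesOver F₀ p) → ((σ.localFields p).k v)ˣ)
    (hconst : ∀ (i : Fin lstar) (e : Fin ((i : ℕ) + 1 + 1) → placesOver F₀ p) (a : Fin ((i : ℕ) + 1 + 1)),
      ‖(t i (e a) : (σ.localFields p).k (e a))‖ = ‖(t i (e (Fin.last _)) : (σ.localFields p).k (e (Fin.last _)))‖)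
    (H : (j : ℕ) → (e : Fin (j + 1) → placesOver F₀ p) →
      Subgroup (PacketAlgebra p (fun b => (σ.localFields p).k (e b)) ≃ₗ[ℚ_[p]]
        PacketAlgebra p (fun b => (σ.localFields p).k (e b))))
    (hH : ∀ j e, ∀ g ∈ H j e,
      ∃ ψ : ∀ b : Fin (j + 1), Carrier (.inr (σ.lift (e b).1) : Thm311.Real.Place K) ≃ₗ[ℚ]
          Carrier (.inr (σ.lift (e b).1) : Thm311.Real.Place K),
        (∀ b, ψ b ∈ ismIsm (analyticLogv K) (σ.lift (e b).1)) ∧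
        ∀ x : ∀ b, (σ.localFields p).k (e b),
          (g : PacketAlgebra p (fun b => (σ.localFields p).k (e b)) ≃ₗ[ℚ_[p]]
              PacketAlgebra p (fun b => (σ.localFields p).k (e b))) (PiTensorProduct.tprod ℚ_[p] x) =
            PiTensorProduct.tprod ℚ_[p] (fun b =>
              RescaledCompletion.of K p (σ.lift (e b).1) (σ.natCast_mem_lift (e b))
                (ψ b ((RescaledCompletion.of K p (σ.lift (e b).1) (σ.natCast_mem_lift (e b))).symm (x b))))) :
    (realPrimePacketWith p (σ.localFields p) c hc0 hcσ).lnνLp lstar (fun j e =>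
        packetHull p (fun b => (σ.localFields p).k (e b))
          (⋃ g : H j e, (g : PacketAlgebra p (fun b => (σ.localFields p).k (e b)) ≃ₗ[ℚ_[p]]
              PacketAlgebra p (fun b => (σ.localFields p).k (e b))) ''
            ⋃ τ : Equiv.Perm (Fin (j + 1)), (realPrimePacketWith p (σ.localFields p) c hc0 hcσ).perm τ e ''
              (realPrimePacketWith p (σ.localFields p) c hc0 hcσ).pilotRegion t j (e ∘ τ))) =
      (realPrimePacketWith p (σ.localFields p) c hc0 hcσ).lnνLp lstar
        ((realPrimePacketWith p (σ.localFields p) c hc0 hcσ).pilotRegion t) := by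
  rw [realPrimePacketWith_lnνLp_hull_orbitH_slotUnion_eq_hull_orbitH_of_norm_eq p (σ.localFields p) c hc0 hcσ t hconst H]
  exact localFields_lnνLp_hull_printInd2_eq_pilotRegion σ p c hc0 hcσ t H hH

end GenuinePacket

end Summit.ABC.IUTFork

/-! ## 3. Input level and datum level -/

namespace Literature.IUT.LogVolume

open Summit.ABC.IUTFork Summit.ABC.IUTFork.Thm311.Real Literature.NumberTheory.NumberFields

namespace ThetaVolumeInput

variable {F₀ : Type} [Field F₀] [NumberField F₀] {K : Type} [Field K] [NumberField K] [Algebra F₀ K]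
variable (I : ThetaVolumeInput F₀ K)

/-- **`−|log(Θ)|^{nonarch}` IN READING (U) COMPUTED OVER PRINT's (Ind2) IS `−deĝ̲_lgp(P_Θ)` at slot-constant inputs.** For a genuine input `I`
whose Θ-ideles have, at each support prime, degree and collection, slot-constant absolute values, and ANY family `H` of packet automorphisms
DOMINATED BY PRINT's (Ind2): `Σ_{p∈T(I)} ln ν̄_{𝕃_p}(v⃗ ↦ hull(⋃_{g∈H_{p,v⃗}} g(⋃_σ σ·O_𝕃(−P_Θ)_{v⃗∘σ}))) = −deĝ̲_lgp(P_Θ)` — ZERO (Ind1)+(Ind2)-gain in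
Mochizuki's «hull of the union of the possible images» reading with Dupuy–Hilado's (Ind1). [cite: Mochizuki2012, IUTchIII Cor. 3.12 p. 174]
[cite: Mochizuki2012, IUTchIV Thm. 1.10 Step (v) p. 27–28] [cite: DupuyHilado2025, §4.7, §4.11, Thm. 3.10.1] [claim: Mochizuki2012, status: disputed] -/
theorem sum_lnνLp_hull_printInd2_union_eq_neg_ndegLgp_of_norm_eq
    (hconst : ∀ (p : ℕ) (hp : p.Prime), haveI : Fact p.Prime := ⟨hp⟩
      ∀ (i : Fin I.lstar) (e : Fin ((i : ℕ) + 1 + 1) → placesOver F₀ p) (a : Fin ((i : ℕ) + 1 + 1)),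
        ‖((I.tΘ p hp i (e a)).val : (I.σ.localFieldFamily p hp).k (e a))‖ =
          ‖((I.tΘ p hp i (e (Fin.last _))).val : (I.σ.localFieldFamily p hp).k (e (Fin.last _)))‖)
    (H : (p : ℕ) → (hp : p.Prime) → (j : ℕ) → (e : Fin (j + 1) → placesOver F₀ p) →
      haveI : Fact p.Prime := ⟨hp⟩
      Subgroup (PacketAlgebra p (fun b => (I.σ.localFields p).k (e b)) ≃ₗ[ℚ_[p]]
        PacketAlgebra p (fun b => (I.σ.localFields p).k (e b))))
    (hH : ∀ (p : ℕ) (hp : p.Prime), haveI : Fact p.Prime := ⟨hp⟩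
      ∀ j e, ∀ g ∈ H p hp j e,
        ∃ ψ : ∀ b : Fin (j + 1), Carrier (.inr (I.σ.lift (e b).1) : Thm311.Real.Place K) ≃ₗ[ℚ]
            Carrier (.inr (I.σ.lift (e b).1) : Thm311.Real.Place K),
          (∀ b, ψ b ∈ ismIsm (analyticLogv K) (I.σ.lift (e b).1)) ∧
          ∀ x : ∀ b, (I.σ.localFields p).k (e b),
            (g : PacketAlgebra p (fun b => (I.σ.localFields p).k (e b)) ≃ₗ[ℚ_[p]]
                PacketAlgebra p (fun b => (I.σ.localFields p).k (e b))) (PiTensorProduct.tprod ℚ_[p] x) =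
              PiTensorProduct.tprod ℚ_[p] (fun b =>
                RescaledCompletion.of K p (I.σ.lift (e b).1) (I.σ.natCast_mem_lift (e b))
                  (ψ b ((RescaledCompletion.of K p (I.σ.lift (e b).1) (I.σ.natCast_mem_lift (e b))).symm (x b))))) :
    (∑ p ∈ I.supportPrimes,
        if hp : p.Prime then
          (haveI : Fact p.Prime := ⟨hp⟩
           (I.packetAt p hp).lnνLp I.lstar (fun j e =>
             packetHull p (fun b => (I.σ.localFields p).k (e b))
               (⋃ g : H p hp j e, (g : PacketAlgebra p (fun b => (I.σ.localFields p).k (e b)) ≃ₗ[ℚ_[p]]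
                   PacketAlgebra p (fun b => (I.σ.localFields p).k (e b))) ''
                 ⋃ τ : Equiv.Perm (Fin (j + 1)), (I.packetAt p hp).perm τ e ''
                   (I.packetAt p hp).pilotRegion (I.tΘ p hp) j (e ∘ τ))))
        else 0) =
      -LgpDivisor.ndegLgp I.X.thetaPilot := by
  rw [← DHData.sum_lnνLp_pilotRegion_eq_neg_ndegLgp I]
  refine Finset.sum_congr rfl fun p hpT => ?_
  have hp : p.Prime := I.prime_of_mem_supportPrimes hpT
  rw [dif_pos hp, dif_pos hp]
  haveI : Fact p.Prime := ⟨hp⟩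
  exact localFields_lnνLp_hull_printInd2_slotUnion_eq_pilotRegion_of_norm_eq I.σ p (mScale p (I.σ.localFields p))
    (mScale_ne_zero p (I.σ.localFields p)) (mScale_perm p (I.σ.localFields p)) (I.tΘ p hp) (hconst p hp) (H p hp) (hH p hp)

/-- **Slot-constancy is automatic for `F₀` of degree one** (`[F₀ : ℚ] = 1`: ONE place over each prime, abc-iut-S2's
`placesOver_subsingleton_of_finrank_eq_one`). [folklore] -/
theorem tΘ_norm_slotConstant_of_finrank_eq_one (hF : Module.finrank ℚ F₀ = 1) :
    ∀ (p : ℕ) (hp : p.Prime), haveI : Fact p.Prime := ⟨hp⟩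
      ∀ (i : Fin I.lstar) (e : Fin ((i : ℕ) + 1 + 1) → placesOver F₀ p) (a : Fin ((i : ℕ) + 1 + 1)),
        ‖((I.tΘ p hp i (e a)).val : (I.σ.localFieldFamily p hp).k (e a))‖ =
          ‖((I.tΘ p hp i (e (Fin.last _))).val : (I.σ.localFieldFamily p hp).k (e (Fin.last _)))‖ := by
  intro p hp
  haveI : Fact p.Prime := ⟨hp⟩
  intro i e a
  have h : e a = e (Fin.last _) := DHData.placesOver_subsingleton_of_finrank_eq_one hF p (e a) (e (Fin.last _))
  rw [h]

/-- **`[F₀ : ℚ] = 1` ⟹ the (U)-Θ-side over PRINT's (Ind2) is `−deĝ̲_lgp(P_Θ)`.** [cite: Mochizuki2012, IUTchIII Cor. 3.12 p. 174]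
[cite: DupuyHilado2025, §4.7, Thm. 3.10.1] [claim: Mochizuki2012, status: disputed] -/
theorem sum_lnνLp_hull_printInd2_union_eq_neg_ndegLgp_of_finrank_eq_one (hF : Module.finrank ℚ F₀ = 1)
    (H : (p : ℕ) → (hp : p.Prime) → (j : ℕ) → (e : Fin (j + 1) → placesOver F₀ p) →
      haveI : Fact p.Prime := ⟨hp⟩
      Subgroup (PacketAlgebra p (fun b => (I.σ.localFields p).k (e b)) ≃ₗ[ℚ_[p]]
        PacketAlgebra p (fun b => (I.σ.localFields p).k (e b))))
    (hH : ∀ (p : ℕ) (hp : p.Prime), haveI : Fact p.Prime := ⟨hp⟩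
      ∀ j e, ∀ g ∈ H p hp j e,
        ∃ ψ : ∀ b : Fin (j + 1), Carrier (.inr (I.σ.lift (e b).1) : Thm311.Real.Place K) ≃ₗ[ℚ]
            Carrier (.inr (I.σ.lift (e b).1) : Thm311.Real.Place K),
          (∀ b, ψ b ∈ ismIsm (analyticLogv K) (I.σ.lift (e b).1)) ∧
          ∀ x : ∀ b, (I.σ.localFields p).k (e b),
            (g : PacketAlgebra p (fun b => (I.σ.localFields p).k (e b)) ≃ₗ[ℚ_[p]]
                PacketAlgebra p (fun b => (I.σ.localFields p).k (e b))) (PiTensorProduct.tprod ℚ_[p] x) =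
              PiTensorProduct.tprod ℚ_[p] (fun b =>
                RescaledCompletion.of K p (I.σ.lift (e b).1) (I.σ.natCast_mem_lift (e b))
                  (ψ b ((RescaledCompletion.of K p (I.σ.lift (e b).1) (I.σ.natCast_mem_lift (e b))).symm (x b))))) :
    (∑ p ∈ I.supportPrimes,
        if hp : p.Prime then
          (haveI : Fact p.Prime := ⟨hp⟩
           (I.packetAt p hp).lnνLp I.lstar (fun j e =>
             packetHull p (fun b => (I.σ.localFields p).k (e b))
               (⋃ g : H p hp j e, (g : PacketAlgebra p (fun b => (I.σ.localFields p).k (e b)) ≃ₗ[ℚ_[p]]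
                   PacketAlgebra p (fun b => (I.σ.localFields p).k (e b))) ''
                 ⋃ τ : Equiv.Perm (Fin (j + 1)), (I.packetAt p hp).perm τ e ''
                   (I.packetAt p hp).pilotRegion (I.tΘ p hp) j (e ∘ τ))))
        else 0) =
      -LgpDivisor.ndegLgp I.X.thetaPilot :=
  I.sum_lnνLp_hull_printInd2_union_eq_neg_ndegLgp_of_norm_eq (I.tΘ_norm_slotConstant_of_finrank_eq_one hF) H hH

/-- **Hence, for `[F₀ : ℚ] = 1`, the (U)-inequality over PRINT's (Ind2) squeezes to `deĝ̲_lgp(P_Θ) − deĝ̲(P_q) ≤ ((l+5)/4)·log π`** (HYPOTHESIS,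
inline: `−|log(q)| ≤ [(U)-Θ-side over H] + ((l+5)/4)·log π`). Pure bookkeeping. [cite: Mochizuki2012, IUTchIV Thm. 1.10 Steps (v)–(viii) p. 27–31]
[claim: Mochizuki2012, status: disputed] -/
theorem gap_le_arch_of_union_printInd2_of_finrank_eq_one (hF : Module.finrank ℚ F₀ = 1)
    (H : (p : ℕ) → (hp : p.Prime) → (j : ℕ) → (e : Fin (j + 1) → placesOver F₀ p) →
      haveI : Fact p.Prime := ⟨hp⟩
      Subgroup (PacketAlgebra p (fun b => (I.σ.localFields p).k (e b)) ≃ₗ[ℚ_[p]]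
        PacketAlgebra p (fun b => (I.σ.localFields p).k (e b))))
    (hH : ∀ (p : ℕ) (hp : p.Prime), haveI : Fact p.Prime := ⟨hp⟩
      ∀ j e, ∀ g ∈ H p hp j e,
        ∃ ψ : ∀ b : Fin (j + 1), Carrier (.inr (I.σ.lift (e b).1) : Thm311.Real.Place K) ≃ₗ[ℚ]
            Carrier (.inr (I.σ.lift (e b).1) : Thm311.Real.Place K),
          (∀ b, ψ b ∈ ismIsm (analyticLogv K) (I.σ.lift (e b).1)) ∧
          ∀ x : ∀ b, (I.σ.localFields p).k (e b),
            (g : PacketAlgebra p (fun b => (I.σ.localFields p).k (e b)) ≃ₗ[ℚ_[p]]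
                PacketAlgebra p (fun b => (I.σ.localFields p).k (e b))) (PiTensorProduct.tprod ℚ_[p] x) =
              PiTensorProduct.tprod ℚ_[p] (fun b =>
                RescaledCompletion.of K p (I.σ.lift (e b).1) (I.σ.natCast_mem_lift (e b))
                  (ψ b ((RescaledCompletion.of K p (I.σ.lift (e b).1) (I.σ.natCast_mem_lift (e b))).symm (x b)))))
    (h : I.negAbsLogQ ≤
      (∑ p ∈ I.supportPrimes,
        if hp : p.Prime then
          (haveI : Fact p.Prime := ⟨hp⟩
           (I.packetAt p hp).lnνLp I.lstar (fun j e =>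
             packetHull p (fun b => (I.σ.localFields p).k (e b))
               (⋃ g : H p hp j e, (g : PacketAlgebra p (fun b => (I.σ.localFields p).k (e b)) ≃ₗ[ℚ_[p]]
                   PacketAlgebra p (fun b => (I.σ.localFields p).k (e b))) ''
                 ⋃ τ : Equiv.Perm (Fin (j + 1)), (I.packetAt p hp).perm τ e ''
                   (I.packetAt p hp).pilotRegion (I.tΘ p hp) j (e ∘ τ))))
        else 0) + archLogTheta I.l) :
    LgpDivisor.ndegLgp I.X.thetaPilot - FinDivisor.ndeg F₀ I.X.qPilot ≤ archLogTheta I.l := by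
  rw [I.sum_lnνLp_hull_printInd2_union_eq_neg_ndegLgp_of_finrank_eq_one hF H hH] at h
  unfold negAbsLogQ at h
  linarith

end ThetaVolumeInput

/-! ### At the Θ-data of a point with RATIONAL `j`-invariant -/

namespace Cor22

namespace ThetaVolumeDatumAt

open Literature.NumberTheory.DiophantineGeometry.GenEll

variable {P : NFPoint} {l : ℕ} (T : ThetaVolumeDatumAt P l)

/-- **THE (U)-INEQUALITY OVER PRINT's (Ind2) IS FALSE AT EVERY GENUINE DATUM OF RATIONAL `j`-INVARIANT WITH `l ≥ 5`, `log q^{∤2l}(λ) ≥ 24`.**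
For a genuine datum `T` at `(P, l)` with `λ_P ∈ U`, `l ≥ 5`, `log q^{∤{2,l}}(λ_P) ≥ 24` and `j(E_F) ∈ ℚ` (so `F_mod = ℚ(j)` has degree one, abc-iut-c312-3's
`finrank_fieldOfModuli_eq_one_of_j_mem_range`), and ANY print-dominated family `H`:
`¬ ( −|log(q)| ≤ Σ_p ln ν̄_{𝕃_p}(hull of the H-orbit of the (Ind1)-slot UNION of O_𝕃(−P_Θ)) + ((l+5)/4)·log π )` — Mochizuki's «hull of the
union of the possible images» reading, with Dupuy–Hilado's (Ind1) and print's factorwise `Ism` as (Ind2), FAILS as typed. [cite: Mochizuki2012,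
IUTchIII Cor. 3.12 p. 174; Thm. 3.11 (i) p. 154] [cite: Mochizuki2012, IUTchIV Thm. 1.10 Step (v) p. 27–28] [claim: Mochizuki2012, status: disputed] -/
theorem not_union_printInd2_of_le_of_j_mem_range (hU : P.InU) (h5 : 5 ≤ l) (hQ : 24 ≤ logQAvoid P {2, l})
    (hj : letI := T.instFieldF; letI := T.instNumberFieldF; letI := T.instIsElliptic; T.E.j ∈ Set.range (algebraMap ℚ T.F)) :
    letI := T.instFieldF; letI := T.instNumberFieldF; letI := T.instFieldK; letI := T.instNumberFieldK
    letI := T.instAlgebraK; letI := T.instIsElliptic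
    ∀ (H : (p : ℕ) → (hp : p.Prime) → (j : ℕ) →
        (e : Fin (j + 1) → placesOver (Literature.IUT.HodgeTheaters.fieldOfModuli T.E) p) →
        haveI : Fact p.Prime := ⟨hp⟩
        Subgroup (PacketAlgebra p (fun b => (T.I.σ.localFields p).k (e b)) ≃ₗ[ℚ_[p]]
          PacketAlgebra p (fun b => (T.I.σ.localFields p).k (e b)))),
      (∀ (p : ℕ) (hp : p.Prime), haveI : Fact p.Prime := ⟨hp⟩
        ∀ j e, ∀ g ∈ H p hp j e,
          ∃ ψ : ∀ b : Fin (j + 1), Carrier (.inr (T.I.σ.lift (e b).1) : Thm311.Real.Place T.K) ≃ₗ[ℚ]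
              Carrier (.inr (T.I.σ.lift (e b).1) : Thm311.Real.Place T.K),
            (∀ b, ψ b ∈ ismIsm (analyticLogv T.K) (T.I.σ.lift (e b).1)) ∧
            ∀ x : ∀ b, (T.I.σ.localFields p).k (e b),
              (g : PacketAlgebra p (fun b => (T.I.σ.localFields p).k (e b)) ≃ₗ[ℚ_[p]]
                  PacketAlgebra p (fun b => (T.I.σ.localFields p).k (e b))) (PiTensorProduct.tprod ℚ_[p] x) =
                PiTensorProduct.tprod ℚ_[p] (fun b =>
                  RescaledCompletion.of T.K p (T.I.σ.lift (e b).1) (T.I.σ.natCast_mem_lift (e b))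
                    (ψ b ((RescaledCompletion.of T.K p (T.I.σ.lift (e b).1) (T.I.σ.natCast_mem_lift (e b))).symm (x b))))) →
      ¬ (T.negAbsLogQ ≤
          (∑ p ∈ T.I.supportPrimes,
            if hp : p.Prime then
              (haveI : Fact p.Prime := ⟨hp⟩
               (T.I.packetAt p hp).lnνLp T.I.lstar (fun j e =>
                 packetHull p (fun b => (T.I.σ.localFields p).k (e b))
                   (⋃ g : H p hp j e, (g : PacketAlgebra p (fun b => (T.I.σ.localFields p).k (e b)) ≃ₗ[ℚ_[p]]
                       PacketAlgebra p (fun b => (T.I.σ.localFields p).k (e b))) ''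
                     ⋃ τ : Equiv.Perm (Fin (j + 1)), (T.I.packetAt p hp).perm τ e ''
                       (T.I.packetAt p hp).pilotRegion (T.I.tΘ p hp) j (e ∘ τ))))
            else 0) + ThetaVolumeInput.archLogTheta l) := by
  letI := T.instFieldF; letI := T.instNumberFieldF; letI := T.instFieldK; letI := T.instNumberFieldK
  letI := T.instAlgebraK; letI := T.instIsElliptic
  intro H hH h
  have hF : Module.finrank ℚ (Literature.IUT.HodgeTheaters.fieldOfModuli T.E) = 1 :=
    InitialThetaData.finrank_fieldOfModuli_eq_one_of_j_mem_range hj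
  have hl' : ThetaVolumeInput.archLogTheta T.I.l = ThetaVolumeInput.archLogTheta l := by rw [T.l_eq]
  rw [← hl'] at h
  have hgap := T.I.gap_le_arch_of_union_printInd2_of_finrank_eq_one hF H hH h
  have hg : T.gap = LgpDivisor.ndegLgp T.I.X.thetaPilot - FinDivisor.ndeg _ T.I.X.qPilot := rfl
  rw [← hg, PointDict.gap_eq T hU, hl'] at hgap
  exact absurd hgap (not_le.mpr (arch_lt_gap_of_le h5 hQ))

/-- **In particular at EVERY genuine datum over a RATIONAL point** `ratPoint q` (`q ∉ {0, 1}`; the datum's `j_eq : j(E_F) = j(λ) ∈ ℚ`).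
[cite: Mochizuki2012, IUTchIII Cor. 3.12 p. 174] [claim: Mochizuki2012, status: disputed] -/
theorem not_union_printInd2_ratPoint {q : ℚ} {l : ℕ} (T : ThetaVolumeDatumAt (ratPoint q) l) (h0 : q ≠ 0) (h1 : q ≠ 1)
    (h5 : 5 ≤ l) (hQ : 24 ≤ logQAvoid (ratPoint q) {2, l}) :
    letI := T.instFieldF; letI := T.instNumberFieldF; letI := T.instFieldK; letI := T.instNumberFieldK
    letI := T.instAlgebraK; letI := T.instIsElliptic
    ∀ (H : (p : ℕ) → (hp : p.Prime) → (j : ℕ) →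
        (e : Fin (j + 1) → placesOver (Literature.IUT.HodgeTheaters.fieldOfModuli T.E) p) →
        haveI : Fact p.Prime := ⟨hp⟩
        Subgroup (PacketAlgebra p (fun b => (T.I.σ.localFields p).k (e b)) ≃ₗ[ℚ_[p]]
          PacketAlgebra p (fun b => (T.I.σ.localFields p).k (e b)))),
      (∀ (p : ℕ) (hp : p.Prime), haveI : Fact p.Prime := ⟨hp⟩
        ∀ j e, ∀ g ∈ H p hp j e,
          ∃ ψ : ∀ b : Fin (j + 1), Carrier (.inr (T.I.σ.lift (e b).1) : Thm311.Real.Place T.K) ≃ₗ[ℚ]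
              Carrier (.inr (T.I.σ.lift (e b).1) : Thm311.Real.Place T.K),
            (∀ b, ψ b ∈ ismIsm (analyticLogv T.K) (T.I.σ.lift (e b).1)) ∧
            ∀ x : ∀ b, (T.I.σ.localFields p).k (e b),
              (g : PacketAlgebra p (fun b => (T.I.σ.localFields p).k (e b)) ≃ₗ[ℚ_[p]]
                  PacketAlgebra p (fun b => (T.I.σ.localFields p).k (e b))) (PiTensorProduct.tprod ℚ_[p] x) =
                PiTensorProduct.tprod ℚ_[p] (fun b =>
                  RescaledCompletion.of T.K p (T.I.σ.lift (e b).1) (T.I.σ.natCast_mem_lift (e b))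
                    (ψ b ((RescaledCompletion.of T.K p (T.I.σ.lift (e b).1) (T.I.σ.natCast_mem_lift (e b))).symm (x b))))) →
      ¬ (T.negAbsLogQ ≤
          (∑ p ∈ T.I.supportPrimes,
            if hp : p.Prime then
              (haveI : Fact p.Prime := ⟨hp⟩
               (T.I.packetAt p hp).lnνLp T.I.lstar (fun j e =>
                 packetHull p (fun b => (T.I.σ.localFields p).k (e b))
                   (⋃ g : H p hp j e, (g : PacketAlgebra p (fun b => (T.I.σ.localFields p).k (e b)) ≃ₗ[ℚ_[p]]
                       PacketAlgebra p (fun b => (T.I.σ.localFields p).k (e b))) ''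
                     ⋃ τ : Equiv.Perm (Fin (j + 1)), (T.I.packetAt p hp).perm τ e ''
                       (T.I.packetAt p hp).pilotRegion (T.I.tΘ p hp) j (e ∘ τ))))
            else 0) + ThetaVolumeInput.archLogTheta l) :=
  T.not_union_printInd2_of_le_of_j_mem_range (ratPoint_mem_UPle_one h0 h1).1.1 h5 hQ
    ⟨jInv q, by
      letI := T.instFieldF; letI := T.instNumberFieldF
      rw [eq_ratCast, T.j_eq]
      exact (eq_ratCast _ _).symm⟩

end ThetaVolumeDatumAt

end Cor22

end Literature.IUT.LogVolume

end
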